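import Literature.NumberTheory.Transcendental.HyperlogarithmsDuality
import Literature.NumberTheory.Transcendental.HyperlogarithmsRegularValues
import Literature.NumberTheory.Transcendental.MZVShuffleRegularisationProofs
import Literature.NumberTheory.Transcendental.DrinfeldAssociatorGroupLikeProofs
import HarnessLib

/-!
# Hyperlogarithms on `(0,1)`, VII: Theorem F₁ — convergent integrals over `(0,1)` are MZVs

Seventh layer of the analytic road to `GenusZeroPeriodsMZV` (Brown 2009): the one-variable case of
Brown's evaluation of period integrals by primitives and regularised restriction. We introduce the
class `𝓗 = ℚ[t, t⁻¹, (1-t)⁻¹] ⊗ ℚ⟨e₀,e₁⟩` of functions `Σ F_{β,W} b_β(t) L(t)_W` on `(0,1)`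
(`L = hlogSeries boolLetters false` the regularised multiple polylogarithms), and PROVE:

* `𝓗` is stable under `d/dt` with explicit tables (`hasDerivAt_bval`, `bval_mul_pden`,
  `hasDerivAt_bval_mul_hlogSeries_cons`), and under PRIMITIVES (`Hyperlog.primB`, `Hyperlog.prim`,
  by integration by parts and recursion on the word; `hasDerivAt_hev_prim`);
* every element of `𝓗` has a REGULARISED VALUE at `0⁺` which is rational (`Hyperlog.reg0`,
  `hasRegValue_hev`, from layer VI), and — through the duality `L(1-s) = θ(L'(s)) Z` of layer V — a
  regularised value at `1⁻` which is a `ℚ`-combination of the numbers `Z(reg_ш V)`, i.e. of MZVs of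
  weight `|V|` (`Hyperlog.reg1`, `hasRegValue_hev_one_sub`, `reg1_mem`);
* **Theorem F₁** (`Hyperlog.integral_hev_eq`, `Hyperlog.integral_hev_mem`): if `hev F` is integrable
  on `(0,1)` then `∫₀¹ hev F = reg1 (prim F) - reg0 (prim F) ∈ ∑_{w ≤ maxLen F + 1} 𝒵_w`
  (limits at both ends exist by integrability and are identified with the regularised values by
  the asymptotic uniqueness of layer VI).

This is the base case, and the model for the inductive step, of the fibration argument of
[Brown 2009, §8.3 with Thm 6.26 (Theorem F) and §4.3]; no named fact is introduced.

## References

* F. C. S. Brown, *Multiple zeta values and periods of moduli spaces `𝔐̄_{0,n}`*, Ann. Sci. Éc.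
  Norm. Supér. (4) 42 (2009), 371–489, §4.3, §5.2, §6.5 (Thm 6.26), §8.3. doi:10.24033/asens.2099.
  [BrownENS2009]
-/

noncomputable section

open MeasureTheory intervalIntegral Set Filter
open scoped BigOperators Topology

namespace Literature.NumberTheory.Transcendental

namespace Hyperlog

variable {α : Type*}

/-! ## Theorem F₁: convergent integrals of hyperlogarithmic integrands over `(0,1)`

### The basis of `ℚ[t, 1/t, 1/(1-t)]` and its multiplication/derivation tables -/

section BasisFunctions

/-- Basis of `ℚ[t, t⁻¹, (1-t)⁻¹]`: `pow k = t^k`, `invPow k = t^{-(k+1)}`, `invOneSub k = (1-t)^{-(k+1)}`.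
[folklore] -/
inductive Bfn
  | pow (k : ℕ)
  | invPow (k : ℕ)
  | invOneSub (k : ℕ)
  deriving DecidableEq

/-- The basis functions. [folklore] -/
def bval : Bfn → ℝ → ℝ
  | Bfn.pow k, t => t ^ k
  | Bfn.invPow k, t => (t ^ (k + 1))⁻¹
  | Bfn.invOneSub k, t => ((1 - t) ^ (k + 1))⁻¹

/-- Evaluation of a formal `ℚ`-combination of basis functions. [folklore] -/
def bev (f : Bfn →₀ ℚ) (t : ℝ) : ℝ := f.sum fun β q => (q : ℝ) * bval β t

/-- `bev` is additive. [folklore] -/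
theorem bev_add (f g : Bfn →₀ ℚ) (t : ℝ) : bev (f + g) t = bev f t + bev g t := by
  unfold bev; rw [Finsupp.sum_add_index'] <;> intros <;> simp [add_mul]

/-- `bev` of a single. [folklore] -/
@[simp] theorem bev_single (β : Bfn) (q : ℚ) (t : ℝ) : bev (Finsupp.single β q) t = (q : ℝ) * bval β t := by
  unfold bev; rw [Finsupp.sum_single_index]; simp

/-- `bev` is `ℚ`-linear (scalars). [folklore] -/
theorem bev_smul (q : ℚ) (f : Bfn →₀ ℚ) (t : ℝ) : bev (q • f) t = (q : ℝ) * bev f t := by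
  unfold bev
  rw [Finsupp.sum_smul_index' (fun _ => by simp)]
  simp only [Finsupp.sum, Finset.mul_sum, smul_eq_mul, Rat.cast_mul, mul_assoc]

/-- `bev` of a finite sum of singles over `range`. [folklore] -/
theorem bev_sum_single {ι : Type*} (s : Finset ι) (g : ι → Bfn) (q : ι → ℚ) (t : ℝ) :
    bev (∑ i ∈ s, Finsupp.single (g i) (q i)) t = ∑ i ∈ s, (q i : ℝ) * bval (g i) t := by
  classical
  induction s using Finset.induction_on with
  | empty => simp [bev]
  | insert i s hi IH => rw [Finset.sum_insert hi, bev_add, IH, Finset.sum_insert hi, bev_single]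

/-- The derivative table `∂_t b_β = Σ d_{βγ} b_γ`. [folklore] -/
def dB : Bfn → Bfn →₀ ℚ
  | Bfn.pow 0 => 0
  | Bfn.pow (k + 1) => Finsupp.single (Bfn.pow k) (k + 1)
  | Bfn.invPow k => Finsupp.single (Bfn.invPow (k + 1)) (-(k + 1 : ℚ))
  | Bfn.invOneSub k => Finsupp.single (Bfn.invOneSub (k + 1)) (k + 1)

/-- The multiplication table `b_β · dt/|t - σ_c|` (`c = false`: `1/t`; `c = true`: `1/(1-t)`).
[folklore] -/
def mulPden : Bfn → Bool → Bfn →₀ ℚ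
  | Bfn.pow 0, false => Finsupp.single (Bfn.invPow 0) 1
  | Bfn.pow (k + 1), false => Finsupp.single (Bfn.pow k) 1
  | Bfn.pow k, true => Finsupp.single (Bfn.invOneSub 0) 1 - ∑ j ∈ Finset.range k, Finsupp.single (Bfn.pow j) 1
  | Bfn.invPow k, false => Finsupp.single (Bfn.invPow (k + 1)) 1
  | Bfn.invPow k, true => Finsupp.single (Bfn.invOneSub 0) 1 + ∑ j ∈ Finset.range (k + 1), Finsupp.single (Bfn.invPow j) 1
  | Bfn.invOneSub k, false => Finsupp.single (Bfn.invPow 0) 1 + ∑ j ∈ Finset.range (k + 1), Finsupp.single (Bfn.invOneSub j) 1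
  | Bfn.invOneSub k, true => Finsupp.single (Bfn.invOneSub (k + 1)) 1

/-- The derivative table is correct on `(0,1)`. [folklore] -/
theorem hasDerivAt_bval (β : Bfn) {t : ℝ} (ht : t ∈ Ioo (0 : ℝ) 1) :
    HasDerivAt (bval β) (bev (dB β) t) t := by
  have ht0 : t ≠ 0 := ht.1.ne'
  have ht1 : 1 - t ≠ 0 := by linarith [ht.2]
  cases β with
  | pow k =>
    cases k with
    | zero =>
      show HasDerivAt (fun t : ℝ => t ^ 0) (bev 0 t) t
      have h0 : bev 0 t = 0 := by simp [bev]
      rw [h0]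
      simp only [pow_zero]
      exact hasDerivAt_const t 1
    | succ k =>
      show HasDerivAt (fun t => t ^ (k + 1)) (bev (Finsupp.single (Bfn.pow k) (k + 1)) t) t
      rw [bev_single]
      have h := hasDerivAt_pow (k + 1) t
      simp only [Nat.add_sub_cancel] at h
      refine h.congr_deriv ?_
      show ((k + 1 : ℕ) : ℝ) * t ^ k = ((k + 1 : ℚ) : ℝ) * bval (Bfn.pow k) t
      simp only [bval]; push_cast; ring
  | invPow k =>
    show HasDerivAt (fun t => (t ^ (k + 1))⁻¹) (bev (Finsupp.single (Bfn.invPow (k + 1)) (-(k + 1 : ℚ))) t) t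
    rw [bev_single]
    have h := (hasDerivAt_pow (k + 1) t).inv (pow_ne_zero _ ht0)
    refine h.congr_deriv ?_
    show -(((k + 1 : ℕ) : ℝ) * t ^ (k + 1 - 1)) / (t ^ (k + 1)) ^ 2 = ((-(k + 1 : ℚ) : ℚ) : ℝ) * bval (Bfn.invPow (k + 1)) t
    simp only [Nat.add_sub_cancel, bval]
    push_cast
    field_simp
    ring
  | invOneSub k =>
    show HasDerivAt (fun t => ((1 - t) ^ (k + 1))⁻¹) (bev (Finsupp.single (Bfn.invOneSub (k + 1)) (k + 1)) t) t
    rw [bev_single]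
    have h1 : HasDerivAt (fun t : ℝ => (1 - t) ^ (k + 1)) (((k + 1 : ℕ) : ℝ) * (1 - t) ^ (k + 1 - 1) * (-1)) t :=
      (hasDerivAt_pow (k + 1) (1 - t)).comp t ((hasDerivAt_id t).const_sub 1)
    have h := h1.inv (pow_ne_zero _ ht1)
    refine h.congr_deriv ?_
    show -(((k + 1 : ℕ) : ℝ) * (1 - t) ^ (k + 1 - 1) * (-1)) / ((1 - t) ^ (k + 1)) ^ 2 =
      ((k + 1 : ℚ) : ℝ) * bval (Bfn.invOneSub (k + 1)) t
    simp only [Nat.add_sub_cancel, bval]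
    push_cast
    field_simp
    ring

/-- Partial fractions `1/(t^{k+1}(1-t)) = 1/(1-t) + Σ_{j ≤ k} 1/t^{j+1}`. [folklore] -/
theorem inv_pow_mul_inv_one_sub (k : ℕ) {t : ℝ} (ht0 : t ≠ 0) (ht1 : 1 - t ≠ 0) :
    (t ^ (k + 1))⁻¹ * (1 - t)⁻¹ = (1 - t)⁻¹ + ∑ j ∈ Finset.range (k + 1), (t ^ (j + 1))⁻¹ := by
  induction k with
  | zero =>
    rw [Finset.sum_range_one]
    field_simp
    ring
  | succ k IH =>
    rw [Finset.sum_range_succ, ← add_assoc, ← IH]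
    field_simp
    ring

/-- Partial fractions `1/((1-t)^{k+1} t) = 1/t + Σ_{j ≤ k} 1/(1-t)^{j+1}`. [folklore] -/
theorem inv_one_sub_pow_mul_inv (k : ℕ) {t : ℝ} (ht0 : t ≠ 0) (ht1 : 1 - t ≠ 0) :
    ((1 - t) ^ (k + 1))⁻¹ * t⁻¹ = t⁻¹ + ∑ j ∈ Finset.range (k + 1), ((1 - t) ^ (j + 1))⁻¹ := by
  induction k with
  | zero =>
    rw [Finset.sum_range_one]
    field_simp
    ring
  | succ k IH =>
    rw [Finset.sum_range_succ, ← add_assoc, ← IH]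
    field_simp
    ring

/-- `t^k/(1-t) = 1/(1-t) - Σ_{j<k} t^j`. [folklore] -/
theorem pow_mul_inv_one_sub (k : ℕ) {t : ℝ} (ht1 : 1 - t ≠ 0) :
    t ^ k * (1 - t)⁻¹ = (1 - t)⁻¹ - ∑ j ∈ Finset.range k, t ^ j := by
  have h := geom_sum_eq (x := t) (fun h => ht1 (by rw [h, sub_self])) k
  have h' : ∑ j ∈ Finset.range k, t ^ j = (1 - t ^ k) * (1 - t)⁻¹ := by
    rw [h, ← neg_sub 1 (t ^ k), ← neg_sub 1 t, neg_div_neg_eq, div_eq_mul_inv]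
  rw [h']
  ring

/-- The table entry for `t^k/(1-t)`. [folklore] -/
theorem mulPden_pow_true (k : ℕ) :
    mulPden (Bfn.pow k) true = Finsupp.single (Bfn.invOneSub 0) 1 - ∑ j ∈ Finset.range k, Finsupp.single (Bfn.pow j) 1 := by
  cases k <;> rfl

/-- The multiplication table is correct on `(0,1)`: `b_β(t)/|t - σ_c| = bev (mulPden β c) t`. [folklore] -/
theorem bval_mul_pden (β : Bfn) (c : Bool) {t : ℝ} (ht : t ∈ Ioo (0 : ℝ) 1) :
    bval β t * pden boolLetters c t = bev (mulPden β c) t := by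
  have ht0 : t ≠ 0 := ht.1.ne'
  have ht1 : 1 - t ≠ 0 := by linarith [ht.2]
  have hpf : pden boolLetters false t = t⁻¹ := by
    rw [pden_of_eq_zero (σ := boolLetters) rfl ht.1, one_div]
  have hpt : pden boolLetters true t = (1 - t)⁻¹ := by
    rw [pden_of_ne_zero boolLetters_adm (by simp [boolLetters]) ht.2]; simp [boolLetters]
  cases β with
  | pow k =>
    cases c
    · rw [hpf]
      cases k with
      | zero => show t ^ 0 * t⁻¹ = bev (Finsupp.single (Bfn.invPow 0) 1) t; rw [bev_single]; simp [bval]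
      | succ k =>
        show t ^ (k + 1) * t⁻¹ = bev (Finsupp.single (Bfn.pow k) 1) t
        rw [bev_single]; simp only [bval, Rat.cast_one, one_mul]
        rw [pow_succ, mul_assoc, mul_inv_cancel₀ ht0, mul_one]
    · rw [hpt, mulPden_pow_true]
      show t ^ k * (1 - t)⁻¹ = bev (Finsupp.single (Bfn.invOneSub 0) 1 - ∑ j ∈ Finset.range k, Finsupp.single (Bfn.pow j) 1) t
      have hneg : (Finsupp.single (Bfn.invOneSub 0) (1 : ℚ) - ∑ j ∈ Finset.range k, Finsupp.single (Bfn.pow j) 1) =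
          Finsupp.single (Bfn.invOneSub 0) 1 + (-1 : ℚ) • ∑ j ∈ Finset.range k, Finsupp.single (Bfn.pow j) 1 := by
        rw [neg_one_smul, sub_eq_add_neg]
      rw [hneg, bev_add, bev_single, bev_smul, bev_sum_single, pow_mul_inv_one_sub k ht1]
      simp [bval]
      ring
  | invPow k =>
    cases c
    · rw [hpf]
      show (t ^ (k + 1))⁻¹ * t⁻¹ = bev (Finsupp.single (Bfn.invPow (k + 1)) 1) t
      rw [bev_single]; simp only [bval, Rat.cast_one, one_mul]
      rw [← mul_inv, ← pow_succ]
    · rw [hpt]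
      show (t ^ (k + 1))⁻¹ * (1 - t)⁻¹ = bev (Finsupp.single (Bfn.invOneSub 0) 1 + ∑ j ∈ Finset.range (k + 1), Finsupp.single (Bfn.invPow j) 1) t
      rw [bev_add, bev_single, bev_sum_single, inv_pow_mul_inv_one_sub k ht0 ht1]
      simp [bval]
  | invOneSub k =>
    cases c
    · rw [hpf]
      show ((1 - t) ^ (k + 1))⁻¹ * t⁻¹ = bev (Finsupp.single (Bfn.invPow 0) 1 + ∑ j ∈ Finset.range (k + 1), Finsupp.single (Bfn.invOneSub j) 1) t
      rw [bev_add, bev_single, bev_sum_single, inv_one_sub_pow_mul_inv k ht0 ht1]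
      simp [bval]
    · rw [hpt]
      show ((1 - t) ^ (k + 1))⁻¹ * (1 - t)⁻¹ = bev (Finsupp.single (Bfn.invOneSub (k + 1)) 1) t
      rw [bev_single]; simp only [bval, Rat.cast_one, one_mul]
      rw [← mul_inv, ← pow_succ]

end BasisFunctions

/-! ### The class `𝓗 = ℚ[t,1/t,1/(1-t)] ⊗ ℚ⟨words⟩` of hyperlogarithmic functions on `(0,1)` -/

section HClass

/-- Index of the class: a basis function and a word. [folklore] -/
abbrev HIdx := Bfn × List Bool

/-- Evaluation `ev(F)(t) = Σ F_{β,W} b_β(t) L(t)_W`, `L = hlogSeries boolLetters false` the fully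
regularised multiple polylogarithms. [folklore] -/
def hev (F : HIdx →₀ ℚ) (t : ℝ) : ℝ :=
  F.sum fun x q => (q : ℝ) * (bval x.1 t * hlogSeries boolLetters false t x.2)

/-- `hev` of a single. [folklore] -/
@[simp] theorem hev_single (x : HIdx) (q : ℚ) (t : ℝ) :
    hev (Finsupp.single x q) t = (q : ℝ) * (bval x.1 t * hlogSeries boolLetters false t x.2) := by
  unfold hev; rw [Finsupp.sum_single_index]; simp

/-- `hev` is additive. [folklore] -/
theorem hev_add (F G : HIdx →₀ ℚ) (t : ℝ) : hev (F + G) t = hev F t + hev G t := by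
  unfold hev; rw [Finsupp.sum_add_index'] <;> intros <;> simp [add_mul]

/-- `hev 0 = 0`. [folklore] -/
@[simp] theorem hev_zero (t : ℝ) : hev 0 t = 0 := by simp [hev]

/-- `hev` commutes with scalars. [folklore] -/
theorem hev_smul (q : ℚ) (F : HIdx →₀ ℚ) (t : ℝ) : hev (q • F) t = (q : ℝ) * hev F t := by
  unfold hev
  rw [Finsupp.sum_smul_index' (fun _ => by simp)]
  simp only [Finsupp.sum, Finset.mul_sum, smul_eq_mul, Rat.cast_mul, mul_assoc]

/-- `hev` as an additive monoid homomorphism into functions (pointwise at `t`). [folklore] -/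
def hevHom (t : ℝ) : (HIdx →₀ ℚ) →+ ℝ where
  toFun F := hev F t
  map_zero' := hev_zero t
  map_add' F G := hev_add F G t

/-- `hev` of a `Finsupp.sum`. [folklore] -/
theorem hev_finsupp_sum {ι : Type*} (f : ι →₀ ℚ) (g : ι → ℚ → HIdx →₀ ℚ) (t : ℝ) :
    hev (f.sum g) t = f.sum fun i m => hev (g i m) t :=
  map_finsuppSum (hevHom t) f g

/-- `hev` of a finite sum. [folklore] -/
theorem hev_finset_sum {ι : Type*} (s : Finset ι) (g : ι → HIdx →₀ ℚ) (t : ℝ) :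
    hev (∑ i ∈ s, g i) t = ∑ i ∈ s, hev (g i) t :=
  map_sum (hevHom t) g s

/-- The basis functions are continuous on `(0,1)`. [folklore] -/
theorem continuousOn_bval (β : Bfn) : ContinuousOn (bval β) (Ioo 0 1) :=
  continuousOn_of_forall_continuousAt fun _ ht => (hasDerivAt_bval β ht).continuousAt

/-- **Derivative of a basic product** `b_β(t) L(t)_{cW}`:
`∂_t (b_β L_{cW}) = (∂b_β) L_{cW} + (b_β/|t-σ_c|) L_W`, both re-expanded in the basis. [folklore] -/
theorem hasDerivAt_bval_mul_hlogSeries_cons (β : Bfn) (c : Bool) (W : List Bool) {t : ℝ}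
    (ht : t ∈ Ioo (0 : ℝ) 1) :
    HasDerivAt (fun t => bval β t * hlogSeries boolLetters false t (c :: W))
      (bev (dB β) t * hlogSeries boolLetters false t (c :: W) +
        bev (mulPden β c) t * hlogSeries boolLetters false t W) t := by
  have h := (hasDerivAt_bval β ht).mul
    (hasDerivAt_hlogSeries_cons (σ := boolLetters) rfl boolLetters_adm' c W ht)
  refine h.congr_deriv ?_
  rw [← bval_mul_pden β c ht]; ring

/-- Derivative of `b_β(t) L(t)_∅ = b_β(t)` on `(0,1)`. [folklore] -/
theorem hasDerivAt_bval_mul_hlogSeries_nil (β : Bfn) {t : ℝ} (ht : t ∈ Ioo (0 : ℝ) 1) :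
    HasDerivAt (fun t => bval β t * hlogSeries boolLetters false t [])
      (bev (dB β) t * hlogSeries boolLetters false t []) t := by
  have hL : ∀ᶠ t' in 𝓝 t, hlogSeries boolLetters false t' [] = 1 := by
    filter_upwards [KZ3.isOpen_Ioo01.mem_nhds ht] with t' ht'
    exact hlogSeries_nil (σ := boolLetters) rfl boolLetters_adm' ht'
  rw [hlogSeries_nil (σ := boolLetters) rfl boolLetters_adm' ht, mul_one]
  refine (hasDerivAt_bval β ht).congr_of_eventuallyEq ?_
  filter_upwards [hL] with t' ht'
  rw [ht', mul_one]

/-! ### Primitives inside the class -/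

/-- **Primitive of `b_β L_W` inside the class**, by integration by parts and recursion on the word
(the recursive calls are on the shorter word `W`): `∫ L_W/t = L_{0W}`, `∫ L_W/(1-t) = L_{1W}`, and
`∫ t^k L_{cW} = t^{k+1}L_{cW}/(k+1) - (k+1)⁻¹ ∫ (t^{k+1}/|t-σ_c|) L_W` etc. [folklore] -/
def primB : Bfn → List Bool → (HIdx →₀ ℚ)
  | Bfn.pow k, [] => Finsupp.single (Bfn.pow (k + 1), []) (1 / (k + 1 : ℚ))
  | Bfn.invPow 0, W => Finsupp.single (Bfn.pow 0, false :: W) 1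
  | Bfn.invPow (k + 1), [] => Finsupp.single (Bfn.invPow k, []) (-(1 / (k + 1 : ℚ)))
  | Bfn.invOneSub 0, W => Finsupp.single (Bfn.pow 0, true :: W) 1
  | Bfn.invOneSub (k + 1), [] => Finsupp.single (Bfn.invOneSub k, []) (1 / (k + 1 : ℚ))
  | Bfn.pow k, c :: W => Finsupp.single (Bfn.pow (k + 1), c :: W) (1 / (k + 1 : ℚ))
      - (1 / (k + 1 : ℚ)) • (mulPden (Bfn.pow (k + 1)) c).sum (fun γ m => m • primB γ W)
  | Bfn.invPow (k + 1), c :: W => Finsupp.single (Bfn.invPow k, c :: W) (-(1 / (k + 1 : ℚ)))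
      + (1 / (k + 1 : ℚ)) • (mulPden (Bfn.invPow k) c).sum (fun γ m => m • primB γ W)
  | Bfn.invOneSub (k + 1), c :: W => Finsupp.single (Bfn.invOneSub k, c :: W) (1 / (k + 1 : ℚ))
      - (1 / (k + 1 : ℚ)) • (mulPden (Bfn.invOneSub k) c).sum (fun γ m => m • primB γ W)

/-- Derivative of `hev` of a recursive sum `Σ_γ m_γ primB γ W` from the derivatives of the pieces.
[folklore] -/
theorem hasDerivAt_hev_sum (f : Bfn →₀ ℚ) (W : List Bool) {t : ℝ}
    (IH : ∀ γ, HasDerivAt (hev (primB γ W)) (bval γ t * hlogSeries boolLetters false t W) t) :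
    HasDerivAt (hev (f.sum fun γ m => m • primB γ W))
      (bev f t * hlogSeries boolLetters false t W) t := by
  have hfun : hev (f.sum fun γ m => m • primB γ W) = fun t => ∑ γ ∈ f.support, (f γ : ℝ) * hev (primB γ W) t := by
    funext t'
    rw [hev_finsupp_sum]
    simp only [Finsupp.sum, hev_smul]
  rw [hfun]
  have h := HasDerivAt.sum (u := f.support) (A := fun γ t => (f γ : ℝ) * hev (primB γ W) t)
    (A' := fun γ => (f γ : ℝ) * (bval γ t * hlogSeries boolLetters false t W)) (x := t)
    fun γ _ => (IH γ).const_mul _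
  have hfun2 : (fun t => ∑ γ ∈ f.support, (f γ : ℝ) * hev (primB γ W) t) =
      ∑ γ ∈ f.support, fun t => (f γ : ℝ) * hev (primB γ W) t := by
    funext t'; rw [Finset.sum_apply]
  rw [hfun2]
  refine h.congr_deriv ?_
  unfold bev
  simp only [Finsupp.sum, Finset.sum_mul, mul_assoc]

/-- **The primitive is correct**: `∂_t hev(primB β W) = b_β(t) L(t)_W` on `(0,1)`. [folklore] -/
theorem hasDerivAt_hev_primB : ∀ (W : List Bool) (β : Bfn) {t : ℝ}, t ∈ Ioo (0 : ℝ) 1 →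
    HasDerivAt (hev (primB β W)) (bval β t * hlogSeries boolLetters false t W) t := by
  intro W
  induction W with
  | nil =>
    intro β t ht
    have ht0 : t ≠ 0 := ht.1.ne'
    have ht1 : 1 - t ≠ 0 := by linarith [ht.2]
    have hL1 := hlogSeries_nil (σ := boolLetters) rfl boolLetters_adm' ht
    cases β with
    | pow k =>
      show HasDerivAt (hev (Finsupp.single (Bfn.pow (k + 1), []) (1 / (k + 1 : ℚ)))) _ t
      have hf : hev (Finsupp.single (Bfn.pow (k + 1), ([] : List Bool)) (1 / (k + 1 : ℚ))) =
          fun t => ((1 / (k + 1 : ℚ) : ℚ) : ℝ) * (bval (Bfn.pow (k + 1)) t * hlogSeries boolLetters false t []) := by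
        funext t'; rw [hev_single]
      rw [hf]
      refine ((hasDerivAt_bval_mul_hlogSeries_nil (Bfn.pow (k + 1)) ht).const_mul _).congr_deriv ?_
      show ((1 / (k + 1 : ℚ) : ℚ) : ℝ) * (bev (Finsupp.single (Bfn.pow k) (k + 1)) t * hlogSeries boolLetters false t []) =
        bval (Bfn.pow k) t * hlogSeries boolLetters false t []
      rw [bev_single, hL1]; push_cast; field_simp
    | invPow k =>
      cases k with
      | zero =>
        show HasDerivAt (hev (Finsupp.single (Bfn.pow 0, [false]) 1)) _ t
        have hf : hev (Finsupp.single (Bfn.pow 0, [false]) (1 : ℚ)) =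
            fun t => ((1 : ℚ) : ℝ) * (bval (Bfn.pow 0) t * hlogSeries boolLetters false t [false]) := by
          funext t'; rw [hev_single]
        rw [hf]
        refine ((hasDerivAt_bval_mul_hlogSeries_cons (Bfn.pow 0) false [] ht).const_mul _).congr_deriv ?_
        show ((1 : ℚ) : ℝ) * (bev (dB (Bfn.pow 0)) t * hlogSeries boolLetters false t [false] +
          bev (mulPden (Bfn.pow 0) false) t * hlogSeries boolLetters false t []) = bval (Bfn.invPow 0) t * hlogSeries boolLetters false t []
        rw [show dB (Bfn.pow 0) = 0 from rfl, show mulPden (Bfn.pow 0) false = Finsupp.single (Bfn.invPow 0) 1 from rfl,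
          bev_single]
        simp [bev]
      | succ k =>
        show HasDerivAt (hev (Finsupp.single (Bfn.invPow k, []) (-(1 / (k + 1 : ℚ))))) _ t
        have hf : hev (Finsupp.single (Bfn.invPow k, ([] : List Bool)) (-(1 / (k + 1 : ℚ)))) =
            fun t => ((-(1 / (k + 1 : ℚ)) : ℚ) : ℝ) * (bval (Bfn.invPow k) t * hlogSeries boolLetters false t []) := by
          funext t'; rw [hev_single]
        rw [hf]
        refine ((hasDerivAt_bval_mul_hlogSeries_nil (Bfn.invPow k) ht).const_mul _).congr_deriv ?_
        show ((-(1 / (k + 1 : ℚ)) : ℚ) : ℝ) * (bev (Finsupp.single (Bfn.invPow (k + 1)) (-(k + 1 : ℚ))) t * hlogSeries boolLetters false t []) =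
          bval (Bfn.invPow (k + 1)) t * hlogSeries boolLetters false t []
        rw [bev_single, hL1]; push_cast; field_simp
    | invOneSub k =>
      cases k with
      | zero =>
        show HasDerivAt (hev (Finsupp.single (Bfn.pow 0, [true]) 1)) _ t
        have hf : hev (Finsupp.single (Bfn.pow 0, [true]) (1 : ℚ)) =
            fun t => ((1 : ℚ) : ℝ) * (bval (Bfn.pow 0) t * hlogSeries boolLetters false t [true]) := by
          funext t'; rw [hev_single]
        rw [hf]
        refine ((hasDerivAt_bval_mul_hlogSeries_cons (Bfn.pow 0) true [] ht).const_mul _).congr_deriv ?_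
        show ((1 : ℚ) : ℝ) * (bev (dB (Bfn.pow 0)) t * hlogSeries boolLetters false t [true] +
          bev (mulPden (Bfn.pow 0) true) t * hlogSeries boolLetters false t []) = bval (Bfn.invOneSub 0) t * hlogSeries boolLetters false t []
        rw [show dB (Bfn.pow 0) = 0 from rfl, mulPden_pow_true, Finset.range_zero, Finset.sum_empty, sub_zero, bev_single]
        simp [bev]
      | succ k =>
        show HasDerivAt (hev (Finsupp.single (Bfn.invOneSub k, []) (1 / (k + 1 : ℚ)))) _ t
        have hf : hev (Finsupp.single (Bfn.invOneSub k, ([] : List Bool)) (1 / (k + 1 : ℚ))) =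
            fun t => ((1 / (k + 1 : ℚ) : ℚ) : ℝ) * (bval (Bfn.invOneSub k) t * hlogSeries boolLetters false t []) := by
          funext t'; rw [hev_single]
        rw [hf]
        refine ((hasDerivAt_bval_mul_hlogSeries_nil (Bfn.invOneSub k) ht).const_mul _).congr_deriv ?_
        show ((1 / (k + 1 : ℚ) : ℚ) : ℝ) * (bev (Finsupp.single (Bfn.invOneSub (k + 1)) (k + 1)) t * hlogSeries boolLetters false t []) =
          bval (Bfn.invOneSub (k + 1)) t * hlogSeries boolLetters false t []
        rw [bev_single, hL1]; push_cast; field_simp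
  | cons c W IHW =>
    intro β t ht
    have ht0 : t ≠ 0 := ht.1.ne'
    have ht1 : 1 - t ≠ 0 := by linarith [ht.2]
    have IH : ∀ γ, HasDerivAt (hev (primB γ W)) (bval γ t * hlogSeries boolLetters false t W) t :=
      fun γ => IHW γ ht
    -- generic integration by parts step
    have hstep : ∀ (β₀ β₁ : Bfn) (q : ℚ) (f : Bfn →₀ ℚ),
        (q : ℝ) * bev (dB β₀) t = bval β₁ t → (q : ℝ) * bev (mulPden β₀ c) t = (q : ℝ) * bev f t →
        HasDerivAt (hev (Finsupp.single (β₀, c :: W) q - q • f.sum (fun γ m => m • primB γ W)))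
          (bval β₁ t * hlogSeries boolLetters false t (c :: W)) t := by
      intro β₀ β₁ q f h1 h2
      have hf : hev (Finsupp.single (β₀, c :: W) q - q • f.sum (fun γ m => m • primB γ W)) =
          fun t => (q : ℝ) * (bval β₀ t * hlogSeries boolLetters false t (c :: W)) -
            (q : ℝ) * hev (f.sum fun γ m => m • primB γ W) t := by
        funext t'
        rw [sub_eq_add_neg, hev_add, hev_single, ← neg_one_smul ℚ, smul_smul, hev_smul]
        push_cast; ring
      rw [hf]
      refine (((hasDerivAt_bval_mul_hlogSeries_cons β₀ c W ht).const_mul _).sub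
        ((hasDerivAt_hev_sum f W IH).const_mul _)).congr_deriv ?_
      rw [mul_add, ← mul_assoc, h1, ← mul_assoc, h2]; ring
    have hstep' : ∀ (β₀ β₁ : Bfn) (q : ℚ) (f : Bfn →₀ ℚ),
        (q : ℝ) * bev (dB β₀) t = bval β₁ t → (q : ℝ) * bev (mulPden β₀ c) t = (q : ℝ) * bev f t →
        HasDerivAt (hev (Finsupp.single (β₀, c :: W) q + (-q) • f.sum (fun γ m => m • primB γ W)))
          (bval β₁ t * hlogSeries boolLetters false t (c :: W)) t := by
      intro β₀ β₁ q f h1 h2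
      have hf : hev (Finsupp.single (β₀, c :: W) q + (-q) • f.sum (fun γ m => m • primB γ W)) =
          fun t => (q : ℝ) * (bval β₀ t * hlogSeries boolLetters false t (c :: W)) +
            (((-q : ℚ)) : ℝ) * hev (f.sum fun γ m => m • primB γ W) t := by
        funext t'
        rw [hev_add, hev_single, hev_smul]
      rw [hf]
      refine (((hasDerivAt_bval_mul_hlogSeries_cons β₀ c W ht).const_mul _).add
        ((hasDerivAt_hev_sum f W IH).const_mul _)).congr_deriv ?_
      rw [mul_add, ← mul_assoc, h1, ← mul_assoc, h2]; push_cast; ring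
    cases β with
    | pow k =>
      show HasDerivAt (hev (Finsupp.single (Bfn.pow (k + 1), c :: W) (1 / (k + 1 : ℚ))
        - (1 / (k + 1 : ℚ)) • (mulPden (Bfn.pow (k + 1)) c).sum (fun γ m => m • primB γ W))) _ t
      refine hstep (Bfn.pow (k + 1)) (Bfn.pow k) (1 / (k + 1 : ℚ)) _ ?_ rfl
      show ((1 / (k + 1 : ℚ) : ℚ) : ℝ) * bev (Finsupp.single (Bfn.pow k) (k + 1)) t = bval (Bfn.pow k) t
      rw [bev_single]; push_cast; field_simp
    | invPow k =>
      cases k with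
      | zero =>
        show HasDerivAt (hev (Finsupp.single (Bfn.pow 0, false :: c :: W) 1)) _ t
        have hf : hev (Finsupp.single (Bfn.pow 0, false :: c :: W) (1 : ℚ)) =
            fun t => ((1 : ℚ) : ℝ) * (bval (Bfn.pow 0) t * hlogSeries boolLetters false t (false :: c :: W)) := by
          funext t'; rw [hev_single]
        rw [hf]
        refine ((hasDerivAt_bval_mul_hlogSeries_cons (Bfn.pow 0) false (c :: W) ht).const_mul _).congr_deriv ?_
        rw [show dB (Bfn.pow 0) = 0 from rfl, show mulPden (Bfn.pow 0) false = Finsupp.single (Bfn.invPow 0) 1 from rfl,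
          bev_single]
        simp [bev]
      | succ k =>
        show HasDerivAt (hev (Finsupp.single (Bfn.invPow k, c :: W) (-(1 / (k + 1 : ℚ)))
          + (1 / (k + 1 : ℚ)) • (mulPden (Bfn.invPow k) c).sum (fun γ m => m • primB γ W))) _ t
        have h := hstep' (Bfn.invPow k) (Bfn.invPow (k + 1)) (-(1 / (k + 1 : ℚ))) (mulPden (Bfn.invPow k) c) ?_ rfl
        · simpa only [neg_neg] using h
        · show ((-(1 / (k + 1 : ℚ)) : ℚ) : ℝ) * bev (Finsupp.single (Bfn.invPow (k + 1)) (-(k + 1 : ℚ))) t = bval (Bfn.invPow (k + 1)) t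
          rw [bev_single]; push_cast; field_simp
    | invOneSub k =>
      cases k with
      | zero =>
        show HasDerivAt (hev (Finsupp.single (Bfn.pow 0, true :: c :: W) 1)) _ t
        have hf : hev (Finsupp.single (Bfn.pow 0, true :: c :: W) (1 : ℚ)) =
            fun t => ((1 : ℚ) : ℝ) * (bval (Bfn.pow 0) t * hlogSeries boolLetters false t (true :: c :: W)) := by
          funext t'; rw [hev_single]
        rw [hf]
        refine ((hasDerivAt_bval_mul_hlogSeries_cons (Bfn.pow 0) true (c :: W) ht).const_mul _).congr_deriv ?_
        rw [show dB (Bfn.pow 0) = 0 from rfl, mulPden_pow_true, Finset.range_zero, Finset.sum_empty, sub_zero, bev_single]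
        simp [bev]
      | succ k =>
        show HasDerivAt (hev (Finsupp.single (Bfn.invOneSub k, c :: W) (1 / (k + 1 : ℚ))
          - (1 / (k + 1 : ℚ)) • (mulPden (Bfn.invOneSub k) c).sum (fun γ m => m • primB γ W))) _ t
        refine hstep (Bfn.invOneSub k) (Bfn.invOneSub (k + 1)) (1 / (k + 1 : ℚ)) _ ?_ rfl
        show ((1 / (k + 1 : ℚ) : ℚ) : ℝ) * bev (Finsupp.single (Bfn.invOneSub (k + 1)) (k + 1)) t = bval (Bfn.invOneSub (k + 1)) t
        rw [bev_single]; push_cast; field_simp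

/-- **The primitive of an element of the class**, by linearity. [folklore] -/
def prim (F : HIdx →₀ ℚ) : HIdx →₀ ℚ := F.sum fun x q => q • primB x.1 x.2

/-- **`∂_t hev(prim F) = hev F` on `(0,1)`.** [folklore] -/
theorem hasDerivAt_hev_prim (F : HIdx →₀ ℚ) {t : ℝ} (ht : t ∈ Ioo (0 : ℝ) 1) :
    HasDerivAt (hev (prim F)) (hev F t) t := by
  have hfun : hev (prim F) = fun t => ∑ x ∈ F.support, (F x : ℝ) * hev (primB x.1 x.2) t := by
    funext t'
    rw [prim, hev_finsupp_sum]
    simp only [Finsupp.sum, hev_smul]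
  rw [hfun]
  have h := HasDerivAt.sum (u := F.support) (A := fun x t => (F x : ℝ) * hev (primB x.1 x.2) t)
    (A' := fun x => (F x : ℝ) * (bval x.1 t * hlogSeries boolLetters false t x.2)) (x := t)
    fun x _ => (hasDerivAt_hev_primB x.2 x.1 ht).const_mul _
  have hfun2 : (fun t => ∑ x ∈ F.support, (F x : ℝ) * hev (primB x.1 x.2) t) =
      ∑ x ∈ F.support, fun t => (F x : ℝ) * hev (primB x.1 x.2) t := by
    funext t'; rw [Finset.sum_apply]
  rw [hfun2]
  refine h.congr_deriv ?_
  unfold hev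
  simp only [Finsupp.sum]

end HClass

/-! ### Regularised values of the class at `0⁺` and, through the duality, at `1⁻` -/

section ClassRegValues

open Finset

/-- `φ_{W,0} = δ_{W,∅}`: the constant Taylor coefficient of `f₀(a)_W`. [folklore] -/
theorem regCoeff_zero {γ : Type*} [DecidableEq γ] {τ : γ → ℝ} {z : γ} (W : List γ) :
    regCoeff τ z W 0 = if W = [] then 1 else 0 := by
  unfold regCoeff Shuffle.pair
  by_cases hW : W = []
  · subst hW
    rw [if_pos rfl, regEnd_eq_single_of_getLast?_ne (by simp), Finsupp.sum_single_index (by simp)]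
    simp [coeff_nil]
  · rw [if_neg hW]
    refine Finset.sum_eq_zero fun u hu => ?_
    have hlen := length_eq_of_mem_support_regEnd z W hu
    have hne : u ≠ [] := by
      intro h; rw [h, List.length_nil] at hlen
      exact hW (List.length_eq_zero_iff.mp hlen.symm)
    show (Shuffle.regEnd z W) u • coeff τ u 0 = 0
    rw [coeff_zero_of_ne_nil hne, smul_zero]

/-- Taylor data with constant coefficient `1`. [folklore] -/
def HasTaylor1 (ρ : ℝ → ℝ) : Prop := ∃ ψ : ℕ → ℝ, ψ 0 = 1 ∧ HasTaylor ρ ψ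

/-- Products preserve `HasTaylor1`. [folklore] -/
theorem HasTaylor1.mul {ρ₁ ρ₂ : ℝ → ℝ} (h₁ : HasTaylor1 ρ₁) (h₂ : HasTaylor1 ρ₂) :
    HasTaylor1 fun a => ρ₁ a * ρ₂ a := by
  obtain ⟨ψ₁, h10, h₁⟩ := h₁
  obtain ⟨ψ₂, h20, h₂⟩ := h₂
  refine ⟨_, ?_, h₁.mul h₂⟩
  simp [h10, h20]

/-- Natural powers preserve `HasTaylor1`. [folklore] -/
theorem HasTaylor1.pow {ρ : ℝ → ℝ} (h : HasTaylor1 ρ) : ∀ n : ℕ, HasTaylor1 fun a => ρ a ^ n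
  | 0 => ⟨fun i => if i = 0 then 1 else 0, by simp,
      hasTaylor_of_finite 0 (fun i hi => if_neg (by omega)) (Eventually.of_forall fun a => by simp)⟩
  | n + 1 => by
    have := (HasTaylor1.pow h n).mul h
    simpa only [pow_succ] using this

/-- `1 - a` has constant Taylor coefficient `1`. [folklore] -/
theorem hasTaylor1_one_sub : HasTaylor1 fun a : ℝ => 1 - a := by
  refine ⟨fun i => if i = 0 then 1 else if i = 1 then -1 else 0, by simp,
    hasTaylor_of_finite 1 (fun i hi => ?_) (Eventually.of_forall fun a => ?_)⟩
  · rw [if_neg (by omega), if_neg (by omega)]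
  · simp [Finset.sum_range_succ]; ring

/-- `1/(1-a) = Σ aⁱ` has constant Taylor coefficient `1` (remainder `a^{M+1}/(1-a) ≤ 2a^{M+1}` on
`(0,1/2]`). [folklore] -/
theorem hasTaylor1_inv_one_sub : HasTaylor1 fun a : ℝ => (1 - a)⁻¹ := by
  refine ⟨fun _ => 1, rfl, fun M => ⟨2, ?_⟩⟩
  filter_upwards [Ioo_mem_nhdsGT (by norm_num : (0 : ℝ) < 1 / 2)] with a ha
  have h1 : 1 - a ≠ 0 := by linarith [ha.2]
  have hgeom : ∑ i ∈ Finset.range (M + 1), (1 : ℝ) * a ^ i = (1 - a ^ (M + 1)) * (1 - a)⁻¹ := by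
    simp only [one_mul]
    rw [geom_sum_eq (fun h => h1 (by rw [h, sub_self])), ← neg_sub 1 (a ^ (M + 1)), ← neg_sub 1 a,
      neg_div_neg_eq, div_eq_mul_inv]
  rw [hgeom]
  have heq : (1 - a)⁻¹ - (1 - a ^ (M + 1)) * (1 - a)⁻¹ = a ^ (M + 1) * (1 - a)⁻¹ := by ring
  have hnn : 0 ≤ a ^ (M + 1) * (1 - a)⁻¹ :=
    mul_nonneg (pow_nonneg ha.1.le _) (inv_nonneg.2 (by linarith [ha.2]))
  rw [heq, abs_of_nonneg hnn, mul_comm]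
  refine mul_le_mul_of_nonneg_right ?_ (pow_nonneg ha.1.le _)
  rw [inv_le_comm₀ (by linarith [ha.2]) (by norm_num)]; linarith [ha.2]

/-- Regularised value of `ρ(a) L(a)_W` for `ρ` with constant coefficient `1`: `δ_{W,∅}`. [folklore] -/
theorem hasRegValue_taylor1_mul_hlogSeries {γ : Type*} [DecidableEq γ] {τ : γ → ℝ} {z : γ} (hz : τ z = 0)
    (hσz : ∀ c, c ≠ z → 1 ≤ τ c) {ρ : ℝ → ℝ} (hρ : HasTaylor1 ρ) (W : List γ) :
    HasRegValue (fun a => ρ a * hlogSeries τ z a W) (if W = [] then 1 else 0) := by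
  obtain ⟨ψ, h0, hρ⟩ := hρ
  have h := hasRegValue_zpow_mul_taylor_mul_hlogSeries hz hσz hρ 0 W
  simp only [le_refl, if_true, neg_zero, Int.toNat_zero, Finset.Nat.antidiagonal_zero, Finset.sum_singleton,
    h0, one_mul, regCoeff_zero] at h
  refine h.congr ?_
  filter_upwards [self_mem_nhdsWithin] with a _
  rw [zpow_zero, one_mul]

/-- Regularised value of `a^{-(n+1)} L(a)_W`: the Taylor coefficient `φ_{W,n+1}`. [folklore] -/
theorem hasRegValue_inv_pow_mul_hlogSeries {γ : Type*} [DecidableEq γ] {τ : γ → ℝ} {z : γ} (hz : τ z = 0)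
    (hσz : ∀ c, c ≠ z → 1 ≤ τ c) (n : ℕ) (W : List γ) :
    HasRegValue (fun a => (a ^ (n + 1))⁻¹ * hlogSeries τ z a W) (regCoeff τ z W (n + 1)) := by
  have h1 : HasTaylor (fun _ : ℝ => (1 : ℝ)) (fun i => if i = 0 then 1 else 0) :=
    hasTaylor_of_finite 0 (fun i hi => if_neg (by omega)) (Eventually.of_forall fun a => by simp)
  have h := hasRegValue_zpow_mul_taylor_mul_hlogSeries hz hσz h1 (-((n : ℤ) + 1)) W
  have hval : (if -((n : ℤ) + 1) ≤ 0 then ∑ ik ∈ antidiagonal (- -((n : ℤ) + 1)).toNat,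
      (if ik.1 = 0 then (1 : ℝ) else 0) * regCoeff τ z W ik.2 else 0) = regCoeff τ z W (n + 1) := by
    rw [if_pos (by omega), neg_neg, show ((n : ℤ) + 1).toNat = n + 1 by omega]
    rw [Finset.sum_eq_single_of_mem ((0, n + 1) : ℕ × ℕ) (by simp) (fun ik hik hne => ?_)]
    · simp
    · rw [Finset.HasAntidiagonal.mem_antidiagonal] at hik
      rw [if_neg, zero_mul]
      intro h0; apply hne; ext <;> simp <;> omega
  rw [hval] at h
  refine h.congr ?_
  filter_upwards [self_mem_nhdsWithin] with a ha
  have ha0 : 0 < a := ha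
  rw [mul_one, show -((n : ℤ) + 1) = -((n + 1 : ℕ) : ℤ) by push_cast; ring, zpow_neg, zpow_natCast]

/-- Regularised value of `a^{k+1} L(a)_W`: `0`. [folklore] -/
theorem hasRegValue_pow_succ_mul_hlogSeries {γ : Type*} [DecidableEq γ] {τ : γ → ℝ} {z : γ} (hz : τ z = 0)
    (hσz : ∀ c, c ≠ z → 1 ≤ τ c) (k : ℕ) (W : List γ) :
    HasRegValue (fun a => a ^ (k + 1) * hlogSeries τ z a W) 0 := by
  have h1 : HasTaylor (fun _ : ℝ => (1 : ℝ)) (fun i => if i = 0 then 1 else 0) :=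
    hasTaylor_of_finite 0 (fun i hi => if_neg (by omega)) (Eventually.of_forall fun a => by simp)
  have h := hasRegValue_zpow_mul_taylor_mul_hlogSeries hz hσz h1 ((k : ℤ) + 1) W
  rw [if_neg (by omega)] at h
  refine h.congr ?_
  filter_upwards [self_mem_nhdsWithin] with a _
  rw [mul_one, show (k : ℤ) + 1 = ((k + 1 : ℕ) : ℤ) by push_cast; ring, zpow_natCast]

/-- **Regularised value at `0⁺` of a basic product `b_β(a) L(a)_W`.** [folklore] -/
def reg0B : Bfn → List Bool → ℝ
  | Bfn.pow 0, W => if W = [] then 1 else 0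
  | Bfn.pow (_ + 1), _ => 0
  | Bfn.invPow k, W => regCoeff boolLetters false W (k + 1)
  | Bfn.invOneSub _, W => if W = [] then 1 else 0

/-- The basic products have the regularised values `reg0B`. [folklore] -/
theorem hasRegValue_bval_mul_hlogSeries (β : Bfn) (W : List Bool) :
    HasRegValue (fun a => bval β a * hlogSeries boolLetters false a W) (reg0B β W) := by
  cases β with
  | pow k =>
    cases k with
    | zero =>
      have h := hasRegValue_taylor1_mul_hlogSeries (τ := boolLetters) rfl boolLetters_adm'
        ((hasTaylor1_one_sub).pow 0) W
      simp only [pow_zero] at h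
      exact h
    | succ k => exact hasRegValue_pow_succ_mul_hlogSeries (τ := boolLetters) rfl boolLetters_adm' k W
  | invPow k => exact hasRegValue_inv_pow_mul_hlogSeries (τ := boolLetters) rfl boolLetters_adm' k W
  | invOneSub k =>
    have h := hasRegValue_taylor1_mul_hlogSeries (τ := boolLetters) rfl boolLetters_adm'
      (hasTaylor1_inv_one_sub.pow (k + 1)) W
    refine h.congr (Eventually.of_forall fun a => ?_)
    show ((1 - a)⁻¹) ^ (k + 1) * _ = ((1 - a) ^ (k + 1))⁻¹ * _
    rw [inv_pow]

/-- **The regularised value at `0⁺` of an element of the class.** [folklore] -/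
def reg0 (F : HIdx →₀ ℚ) : ℝ := F.sum fun x q => (q : ℝ) * reg0B x.1 x.2

/-- `hev F` has the regularised value `reg0 F` at `0⁺`. [folklore] -/
theorem hasRegValue_hev (F : HIdx →₀ ℚ) : HasRegValue (hev F) (reg0 F) := by
  have h := HasRegValue.sum F.support (φ := fun x a => (F x : ℝ) * (bval x.1 a * hlogSeries boolLetters false a x.2))
    (c := fun x => (F x : ℝ) * reg0B x.1 x.2) fun x _ => (hasRegValue_bval_mul_hlogSeries x.1 x.2).smul _
  exact h

/-- **Regularised value at `1⁻` (in the variable `s = 1 - b`) of a basic product against a word of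
the SWAPPED alphabet**: `b_β(1-s) L'(s)_U`. [folklore] -/
def reg1B : Bfn → List Bool → ℝ
  | Bfn.pow _, U => if U = [] then 1 else 0
  | Bfn.invPow _, U => if U = [] then 1 else 0
  | Bfn.invOneSub k, U => regCoeff boolLetters' true U (k + 1)

/-- The basic products at `1 - s` against `L'(s)_U` have the regularised values `reg1B`. [folklore] -/
theorem hasRegValue_bval_one_sub_mul_hlogSeries' (β : Bfn) (U : List Bool) :
    HasRegValue (fun s => bval β (1 - s) * hlogSeries boolLetters' true s U) (reg1B β U) := by
  cases β with
  | pow k =>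
    have h := hasRegValue_taylor1_mul_hlogSeries (τ := boolLetters') rfl boolLetters'_adm'
      (hasTaylor1_one_sub.pow k) U
    exact h
  | invPow k =>
    have h := hasRegValue_taylor1_mul_hlogSeries (τ := boolLetters') rfl boolLetters'_adm'
      (hasTaylor1_inv_one_sub.pow (k + 1)) U
    refine h.congr (Eventually.of_forall fun s => ?_)
    show ((1 - s)⁻¹) ^ (k + 1) * _ = ((1 - s) ^ (k + 1))⁻¹ * _
    rw [inv_pow]
  | invOneSub k =>
    have h := hasRegValue_inv_pow_mul_hlogSeries (τ := boolLetters') rfl boolLetters'_adm' k U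
    refine h.congr (Eventually.of_forall fun s => ?_)
    show (s ^ (k + 1))⁻¹ * _ = ((1 - (1 - s)) ^ (k + 1))⁻¹ * _
    rw [sub_sub_cancel]

/-- **The regularised value at `1⁻`** of an element of the class:
`Σ_x F_x Σ_{W_x = UV} (-1)^{|U|} reg1B(β_x, U) Z(reg V)`. [folklore] -/
def reg1 (F : HIdx →₀ ℚ) : ℝ :=
  F.sum fun x q => (q : ℝ) * ∑ p ∈ NCSeries.splits x.2,
    (-1) ^ p.1.length * reg1B x.1 p.1 * MZV.zetaWordSum (MZV.shuffleReg p.2)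

/-- `s ↦ hev F (1 - s)` has the regularised value `reg1 F` at `0⁺` (duality!). [folklore] -/
theorem hasRegValue_hev_one_sub (F : HIdx →₀ ℚ) : HasRegValue (fun s => hev F (1 - s)) (reg1 F) := by
  classical
  have hx : ∀ x ∈ F.support, HasRegValue (fun s => (F x : ℝ) * (bval x.1 (1 - s) *
      hlogSeries boolLetters false (1 - s) x.2)) ((F x : ℝ) * ∑ p ∈ NCSeries.splits x.2,
        (-1) ^ p.1.length * reg1B x.1 p.1 * MZV.zetaWordSum (MZV.shuffleReg p.2)) := by
    intro x _
    refine HasRegValue.smul ?_ _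
    have hp : ∀ p ∈ NCSeries.splits x.2, HasRegValue (fun s => bval x.1 (1 - s) *
        (((-1) ^ p.1.length * hlogSeries boolLetters' true s p.1) * MZV.zetaWordSum (MZV.shuffleReg p.2)))
        ((-1) ^ p.1.length * reg1B x.1 p.1 * MZV.zetaWordSum (MZV.shuffleReg p.2)) := by
      intro p _
      have h := ((hasRegValue_bval_one_sub_mul_hlogSeries' x.1 p.1).smul ((-1) ^ p.1.length)).smul
        (MZV.zetaWordSum (MZV.shuffleReg p.2))
      have hv : MZV.zetaWordSum (MZV.shuffleReg p.2) * ((-1) ^ p.1.length * reg1B x.1 p.1) =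
          (-1) ^ p.1.length * reg1B x.1 p.1 * MZV.zetaWordSum (MZV.shuffleReg p.2) := by ring
      rw [hv] at h
      refine h.congr (Eventually.of_forall fun s => ?_)
      ring
    have hsum := HasRegValue.sum (NCSeries.splits x.2) hp
    refine hsum.congr ?_
    filter_upwards [Ioo_mem_nhdsGT (zero_lt_one' ℝ)] with s hs
    rw [hlogSeries_one_sub_eq_sum x.2 hs, Finset.mul_sum]
  have h := HasRegValue.sum F.support hx
  refine h.congr (Eventually.of_forall fun s => ?_)
  unfold hev
  simp only [Finsupp.sum]

end ClassRegValues

/-! ### Theorem F₁: `∫₀¹` of a convergent element of the class is a `ℚ`-combination of MZVs -/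

section TheoremF1

/-- Rationality. [folklore] -/
def IsRat (x : ℝ) : Prop := ∃ q : ℚ, (q : ℝ) = x

/-- Rational casts are rational. [folklore] -/
theorem isRat_ratCast (q : ℚ) : IsRat (q : ℝ) := ⟨q, rfl⟩
/-- `0` is rational. [folklore] -/
theorem isRat_zero : IsRat 0 := ⟨0, by simp⟩
/-- `1` is rational. [folklore] -/
theorem isRat_one : IsRat 1 := ⟨1, by simp⟩
/-- Naturals are rational. [folklore] -/
theorem isRat_natCast (n : ℕ) : IsRat (n : ℝ) := ⟨n, by simp⟩
/-- Sums of rationals. [folklore] -/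
theorem IsRat.add {x y : ℝ} : IsRat x → IsRat y → IsRat (x + y)
  | ⟨p, hp⟩, ⟨q, hq⟩ => ⟨p + q, by rw [Rat.cast_add, hp, hq]⟩
/-- Products of rationals. [folklore] -/
theorem IsRat.mul {x y : ℝ} : IsRat x → IsRat y → IsRat (x * y)
  | ⟨p, hp⟩, ⟨q, hq⟩ => ⟨p * q, by rw [Rat.cast_mul, hp, hq]⟩
/-- Negatives of rationals. [folklore] -/
theorem IsRat.neg {x : ℝ} : IsRat x → IsRat (-x)
  | ⟨p, hp⟩ => ⟨-p, by rw [Rat.cast_neg, hp]⟩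
/-- Inverses of rationals. [folklore] -/
theorem IsRat.inv {x : ℝ} : IsRat x → IsRat x⁻¹
  | ⟨p, hp⟩ => ⟨p⁻¹, by rw [Rat.cast_inv, hp]⟩
/-- Quotients of rationals. [folklore] -/
theorem IsRat.div {x y : ℝ} (hx : IsRat x) (hy : IsRat y) : IsRat (x / y) := by
  rw [div_eq_mul_inv]; exact hx.mul hy.inv
/-- Powers of rationals. [folklore] -/
theorem IsRat.pow {x : ℝ} (hx : IsRat x) : ∀ n : ℕ, IsRat (x ^ n)
  | 0 => by rw [pow_zero]; exact isRat_one
  | n + 1 => by rw [pow_succ]; exact (IsRat.pow hx n).mul hx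
/-- Finite sums of rationals. [folklore] -/
theorem IsRat.sum {ι : Type*} (s : Finset ι) {f : ι → ℝ} (h : ∀ i ∈ s, IsRat (f i)) :
    IsRat (∑ i ∈ s, f i) :=
  Finset.sum_induction f IsRat (fun _ _ => IsRat.add) isRat_zero h
/-- Case distinctions of rationals. [folklore] -/
theorem IsRat.ite {p : Prop} [Decidable p] {x y : ℝ} (hx : IsRat x) (hy : IsRat y) :
    IsRat (if p then x else y) := by
  split_ifs <;> assumption

/-- A rational number lies in `∑_{w ≤ n} 𝒵_w` (`𝒵₀ = ℚ`). [folklore] -/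
theorem IsRat.mem_iSup {x : ℝ} (hx : IsRat x) (n : ℕ) : x ∈ ⨆ (w : ℕ) (_ : w ≤ n), mzvSpace w := by
  obtain ⟨q, rfl⟩ := hx
  have h0 : (q : ℝ) ∈ mzvSpace 0 := by
    rw [mzvSpace_zero_eq, ← Rat.smul_one_eq_cast]
    exact Submodule.smul_mem _ q (Submodule.subset_span rfl)
  exact le_iSup₂ (f := fun (w : ℕ) (_ : w ≤ n) => mzvSpace w) 0 (Nat.zero_le n) h0

/-- `∑_{w ≤ n} 𝒵_w` is stable under rational multiples. [folklore] -/
theorem IsRat.mul_mem_iSup {x y : ℝ} (hx : IsRat x) {n : ℕ} (hy : y ∈ ⨆ (w : ℕ) (_ : w ≤ n), mzvSpace w) :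
    x * y ∈ ⨆ (w : ℕ) (_ : w ≤ n), mzvSpace w := by
  obtain ⟨q, rfl⟩ := hx
  rw [← Rat.smul_def]
  exact Submodule.smul_mem _ q hy

open Finset in
/-- The power-series coefficients of hyperlogarithms with rational letters are rational. [folklore] -/
theorem coeff_isRat {τ : α → ℝ} (hτ : ∀ c, IsRat (τ c)) : ∀ (u : List α) (m : ℕ), IsRat (coeff τ u m)
  | [], m => by rw [coeff_nil]; exact isRat_one.ite isRat_zero
  | c :: u, 0 => by rw [coeff_cons_zero]; exact isRat_zero
  | c :: u, m + 1 => by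
    by_cases hc : τ c = 0
    · rw [coeff_cons_succ_of_eq_zero hc]
      exact (coeff_isRat hτ u (m + 1)).div ((isRat_natCast m).add isRat_one)
    · rw [coeff_cons_succ_of_ne_zero hc]
      refine (IsRat.sum _ fun jk _ => ?_).div ((isRat_natCast m).add isRat_one)
      exact (isRat_one.div ((hτ c).pow _)).mul (coeff_isRat hτ u jk.2)

/-- The Taylor coefficients of the regularised `f₀(a)_W` are rational. [folklore] -/
theorem regCoeff_isRat [DecidableEq α] {τ : α → ℝ} (hτ : ∀ c, IsRat (τ c)) (z : α) (W : List α) (m : ℕ) :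
    IsRat (regCoeff τ z W m) := by
  unfold regCoeff Shuffle.pair
  exact IsRat.sum _ fun u _ => by
    show IsRat ((Shuffle.regEnd z W) u • coeff τ u m)
    rw [Rat.smul_def]; exact (isRat_ratCast _).mul (coeff_isRat hτ u m)

/-- The letters `0, 1` are rational. [folklore] -/
theorem isRat_boolLetters (c : Bool) : IsRat (boolLetters c) := by
  cases c
  · exact ⟨0, by simp [boolLetters]⟩
  · exact ⟨1, by simp [boolLetters]⟩

/-- The swapped letters `1, 0` are rational. [folklore] -/
theorem isRat_boolLetters' (c : Bool) : IsRat (boolLetters' c) := by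
  cases c
  · exact ⟨1, by simp [boolLetters']⟩
  · exact ⟨0, by simp [boolLetters']⟩

/-- The regularised values `reg0B` are rational. [folklore] -/
theorem reg0B_isRat (β : Bfn) (W : List Bool) : IsRat (reg0B β W) := by
  cases β with
  | pow k =>
    cases k with
    | zero => exact isRat_one.ite isRat_zero
    | succ k => exact isRat_zero
  | invPow k => exact regCoeff_isRat isRat_boolLetters false W (k + 1)
  | invOneSub k => exact isRat_one.ite isRat_zero

/-- The regularised values `reg1B` are rational. [folklore] -/
theorem reg1B_isRat (β : Bfn) (U : List Bool) : IsRat (reg1B β U) := by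
  cases β with
  | pow k => exact isRat_one.ite isRat_zero
  | invPow k => exact isRat_one.ite isRat_zero
  | invOneSub k => exact regCoeff_isRat isRat_boolLetters' true U (k + 1)

/-- `ζ` of a convergent word lies in `𝒵_{|v|}`. [folklore] -/
theorem multipleZeta_ofBinaryWord_mem {v : List Bool} (hv : MZV.IsConvergentWord v) :
    multipleZeta (MZV.ofBinaryWord v) ∈ mzvSpace v.length := by
  refine Submodule.subset_span ⟨MZV.ofBinaryWord v, MZV.isAdmissible_ofBinaryWord_of_isConvergentWord hv, ?_, rfl⟩
  rcases hv with rfl | ⟨-, hl⟩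
  · simp
  · exact MZV.weight_ofBinaryWord (by rintro rfl; simp at hl) hl

/-- **`Z(reg_ш V) ∈ ∑_{w ≤ n} 𝒵_w` for `|V| ≤ n`.** [folklore] -/
theorem zetaWordSum_shuffleReg_mem (V : List Bool) {n : ℕ} (hV : V.length ≤ n) :
    MZV.zetaWordSum (MZV.shuffleReg V) ∈ ⨆ (w : ℕ) (_ : w ≤ n), mzvSpace w := by
  unfold MZV.zetaWordSum
  rw [Finsupp.sum]
  refine Submodule.sum_mem _ fun v hv => ?_
  refine (isRat_ratCast _).mul_mem_iSup ?_
  have hmem := multipleZeta_ofBinaryWord_mem (MZV.isConvergentWord_of_mem_support_shuffleReg hv)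
  exact le_iSup₂ (f := fun (w : ℕ) (_ : w ≤ n) => mzvSpace w) v.length
    ((MZV.length_le_of_mem_support_shuffleReg hv).trans hV) hmem

/-- The maximal word length of an element of the class. [folklore] -/
def maxLen (F : HIdx →₀ ℚ) : ℕ := F.support.sup fun x => x.2.length

/-- Word lengths are bounded by `maxLen`. [folklore] -/
theorem length_le_maxLen {F : HIdx →₀ ℚ} {x : HIdx} (hx : x ∈ F.support) : x.2.length ≤ maxLen F :=
  Finset.le_sup (f := fun x : HIdx => x.2.length) hx

/-- `reg0 F` is rational, hence in `∑_{w ≤ n} 𝒵_w`. [folklore] -/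
theorem reg0_mem (F : HIdx →₀ ℚ) (n : ℕ) : reg0 F ∈ ⨆ (w : ℕ) (_ : w ≤ n), mzvSpace w := by
  refine IsRat.mem_iSup ?_ n
  unfold reg0
  exact IsRat.sum _ fun x _ => (isRat_ratCast _).mul (reg0B_isRat x.1 x.2)

/-- **`reg1 F ∈ ∑_{w ≤ n} 𝒵_w` for `maxLen F ≤ n`.** [folklore] -/
theorem reg1_mem (F : HIdx →₀ ℚ) {n : ℕ} (hn : maxLen F ≤ n) : reg1 F ∈ ⨆ (w : ℕ) (_ : w ≤ n), mzvSpace w := by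
  unfold reg1
  rw [Finsupp.sum]
  refine Submodule.sum_mem _ fun x hx => ?_
  refine (isRat_ratCast _).mul_mem_iSup (Submodule.sum_mem _ fun p hp => ?_)
  refine (((isRat_one.neg).pow _).mul (reg1B_isRat x.1 p.1)).mul_mem_iSup (zetaWordSum_shuffleReg_mem p.2 ?_)
  rw [NCSeries.mem_splits] at hp
  have h := length_le_maxLen hx
  rw [← hp, List.length_append] at h
  omega

/-- Word lengths in `primB β W` are at most `|W| + 1`. [folklore] -/
theorem length_le_of_mem_support_primB : ∀ (W : List Bool) (β : Bfn) (x : HIdx),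
    x ∈ (primB β W).support → x.2.length ≤ W.length + 1 := by
  classical
  -- generic bound for the recursive sums
  have hrec : ∀ (W : List Bool) (f : Bfn →₀ ℚ),
      (∀ γ x, x ∈ (primB γ W).support → x.2.length ≤ W.length + 1) →
      ∀ x, x ∈ (f.sum fun γ m => m • primB γ W).support → x.2.length ≤ W.length + 1 := by
    intro W f IH x hx
    have hx' := Finsupp.support_finsetSum hx
    simp only [Finset.mem_biUnion] at hx'
    obtain ⟨γ, -, hγ⟩ := hx'
    exact IH γ x (Finsupp.support_smul hγ)
  have hsingle : ∀ (y x : HIdx) (q : ℚ), x ∈ (Finsupp.single y q).support → x = y :=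
    fun y x q hx => Finset.mem_singleton.1 (Finsupp.support_single_subset hx)
  intro W
  induction W with
  | nil =>
    intro β x hx
    cases β with
    | pow k => rw [hsingle _ _ _ hx]; simp
    | invPow k =>
      cases k with
      | zero => rw [hsingle _ _ _ hx]; simp
      | succ k => rw [hsingle _ _ _ hx]; simp
    | invOneSub k =>
      cases k with
      | zero => rw [hsingle _ _ _ hx]; simp
      | succ k => rw [hsingle _ _ _ hx]; simp
  | cons c W IHW =>
    intro β x hx
    have IH : ∀ γ x, x ∈ (primB γ W).support → x.2.length ≤ W.length + 1 := fun γ x hx => IHW γ x hx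
    have hcase : ∀ (y : HIdx) (q r : ℚ) (f : Bfn →₀ ℚ), y.2.length ≤ (c :: W).length + 1 →
        x ∈ (Finsupp.single y q + r • f.sum (fun γ m => m • primB γ W)).support →
        x.2.length ≤ (c :: W).length + 1 := by
      intro y q r f hy hx
      rcases Finset.mem_union.1 (Finsupp.support_add hx) with h | h
      · rw [hsingle _ _ _ h]; exact hy
      · have := hrec W f IH x (Finsupp.support_smul h)
        simp only [List.length_cons]; omega
    cases β with
    | pow k =>
      refine hcase (Bfn.pow (k + 1), c :: W) (1 / (k + 1 : ℚ)) (-(1 / (k + 1 : ℚ))) (mulPden (Bfn.pow (k + 1)) c)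
        (by simp) ?_
      rw [neg_smul, ← sub_eq_add_neg]; exact hx
    | invPow k =>
      cases k with
      | zero => rw [hsingle _ _ _ hx]; simp
      | succ k =>
        exact hcase (Bfn.invPow k, c :: W) (-(1 / (k + 1 : ℚ))) (1 / (k + 1 : ℚ)) (mulPden (Bfn.invPow k) c)
          (by simp) hx
    | invOneSub k =>
      cases k with
      | zero => rw [hsingle _ _ _ hx]; simp
      | succ k =>
        refine hcase (Bfn.invOneSub k, c :: W) (1 / (k + 1 : ℚ)) (-(1 / (k + 1 : ℚ))) (mulPden (Bfn.invOneSub k) c)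
          (by simp) ?_
        rw [neg_smul, ← sub_eq_add_neg]; exact hx

/-- `maxLen (prim F) ≤ maxLen F + 1`. [folklore] -/
theorem maxLen_prim_le (F : HIdx →₀ ℚ) : maxLen (prim F) ≤ maxLen F + 1 := by
  classical
  refine Finset.sup_le fun x hx => ?_
  unfold prim at hx
  have hx' := Finsupp.support_finsetSum hx
  simp only [Finset.mem_biUnion] at hx'
  obtain ⟨y, hy, hyx⟩ := hx'
  have h1 := length_le_of_mem_support_primB y.2 y.1 x (Finsupp.support_smul hyx)
  have h2 := length_le_maxLen hy
  omega

/-- Elements of the class are continuous on `(0,1)`. [folklore] -/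
theorem continuousOn_hev (F : HIdx →₀ ℚ) : ContinuousOn (hev F) (Ioo 0 1) := by
  have h : hev F = fun t => ∑ x ∈ F.support, (F x : ℝ) * (bval x.1 t * hlogSeries boolLetters false t x.2) := by
    funext t; rfl
  rw [h]
  refine continuousOn_finsetSum _ fun x _ => continuousOn_const.mul ((continuousOn_bval x.1).mul ?_)
  exact continuousOn_hlogSeries (σ := boolLetters) rfl boolLetters_adm' x.2

/-- **Evaluation of a convergent integral by the primitive and the regularised boundary values**:
`∫₀¹ hev F = Reg_{t=1} hev(prim F) - Reg_{t=0} hev(prim F)`. [folklore] -/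
theorem integral_hev_eq (F : HIdx →₀ ℚ) (hint : IntegrableOn (hev F) (Ioo 0 1) volume) :
    ∫ t in Ioo (0 : ℝ) 1, hev F t = reg1 (prim F) - reg0 (prim F) := by
  set G := prim F with hG
  set f₀ : ℝ → ℝ := (Ioo (0 : ℝ) 1).indicator (hev F) with hf₀
  have hf₀i : Integrable f₀ volume := hint.integrable_indicator measurableSet_Ioo
  set P : ℝ → ℝ := fun b => ∫ x in (0 : ℝ)..b, f₀ x with hP
  have hPc : Continuous P := continuous_primitive (fun a b => hf₀i.intervalIntegrable) 0
  -- the fundamental theorem of calculus on `[a,b] ⊂ (0,1)`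
  have hftc : ∀ a ∈ Ioo (0 : ℝ) 1, ∀ b ∈ Ioo (0 : ℝ) 1, hev G b - hev G a = P b - P a := by
    intro a ha b hb
    have hsub : uIcc a b ⊆ Ioo 0 1 := by
      intro x hx
      rw [mem_uIcc] at hx
      rcases hx with ⟨h1, h2⟩ | ⟨h1, h2⟩
      · exact ⟨ha.1.trans_le h1, h2.trans_lt hb.2⟩
      · exact ⟨hb.1.trans_le h1, h2.trans_lt ha.2⟩
    have h1 : ∫ x in a..b, hev F x = hev G b - hev G a :=
      integral_eq_sub_of_hasDerivAt (fun x hx => hasDerivAt_hev_prim F (hsub hx))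
        (((continuousOn_hev F).mono hsub).intervalIntegrable)
    have h2 : ∫ x in a..b, f₀ x = ∫ x in a..b, hev F x :=
      intervalIntegral.integral_congr fun x hx => by rw [hf₀, indicator_of_mem (hsub hx)]
    rw [← h1, ← h2, hP, intervalIntegral.integral_interval_sub_left hf₀i.intervalIntegrable hf₀i.intervalIntegrable]
  have hhalf : (1 / 2 : ℝ) ∈ Ioo (0 : ℝ) 1 := by constructor <;> norm_num
  -- the limit at `0⁺`
  have hlim0 : Tendsto (hev G) (𝓝[>] 0) (𝓝 (hev G (1 / 2) - P (1 / 2) + P 0)) := by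
    have hc : Continuous fun a : ℝ => hev G (1 / 2) - P (1 / 2) + P a := continuous_const.add hPc
    have ht : Tendsto (fun a => hev G (1 / 2) - P (1 / 2) + P a) (𝓝[>] 0) (𝓝 (hev G (1 / 2) - P (1 / 2) + P 0)) :=
      (hc.tendsto 0).mono_left nhdsWithin_le_nhds
    refine ht.congr' ?_
    filter_upwards [Ioo_mem_nhdsGT (zero_lt_one' ℝ)] with a ha
    linarith [hftc a ha (1 / 2) hhalf]
  have hP0 : P 0 = 0 := by rw [hP]; exact intervalIntegral.integral_same
  have hreg0 : hev G (1 / 2) - P (1 / 2) + P 0 = reg0 G := (hasRegValue_hev G).eq_of_tendsto hlim0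
  -- the limit at `1⁻`
  have hlim1 : Tendsto (fun s => hev G (1 - s)) (𝓝[>] 0) (𝓝 (hev G (1 / 2) - P (1 / 2) + P 1)) := by
    have hc : Continuous fun s : ℝ => hev G (1 / 2) - P (1 / 2) + P (1 - s) :=
      continuous_const.add (hPc.comp (continuous_const.sub continuous_id))
    have ht : Tendsto (fun s => hev G (1 / 2) - P (1 / 2) + P (1 - s)) (𝓝[>] 0) (𝓝 (hev G (1 / 2) - P (1 / 2) + P 1)) := by
      have := (hc.tendsto 0).mono_left (nhdsWithin_le_nhds (s := Ioi (0 : ℝ)))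
      simpa using this
    refine ht.congr' ?_
    filter_upwards [Ioo_mem_nhdsGT (zero_lt_one' ℝ)] with s hs
    have hs' : 1 - s ∈ Ioo (0 : ℝ) 1 := ⟨by linarith [hs.2], by linarith [hs.1]⟩
    linarith [hftc (1 - s) hs' (1 / 2) hhalf]
  have hreg1 : hev G (1 / 2) - P (1 / 2) + P 1 = reg1 G := (hasRegValue_hev_one_sub G).eq_of_tendsto hlim1
  -- the integral
  have hzero : ∀ x, x ∉ Ioc (0 : ℝ) 1 → f₀ x = 0 := fun x hx => by
    rw [hf₀]; exact indicator_of_notMem (fun h => hx (Ioo_subset_Ioc_self h)) _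
  have hI : ∫ t in Ioo (0 : ℝ) 1, hev F t = P 1 := by
    rw [hP]
    dsimp only
    rw [intervalIntegral.integral_of_le zero_le_one, setIntegral_eq_integral_of_forall_compl_eq_zero hzero, hf₀,
      MeasureTheory.integral_indicator measurableSet_Ioo]
  rw [hI, ← hreg0, ← hreg1, hP0]
  ring

/-- **Theorem F₁** (Brown 2009, the case `N = 1` of Theorem 6.26 / Lemma 4.10 type statement): the
integral over `(0,1)` of a CONVERGENT element `Σ F_{β,W} b_β(t) L(t)_W` of
`ℚ[t, 1/t, 1/(1-t)] ⊗ (regularised multiple polylogarithms)` is a `ℚ`-linear combination of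
multiple zeta values of weight at most `maxLen F + 1`. [cite: BrownENS2009, §4.3, §6.5] -/
theorem integral_hev_mem (F : HIdx →₀ ℚ) (hint : IntegrableOn (hev F) (Ioo 0 1) volume) :
    (∫ t in Ioo (0 : ℝ) 1, hev F t) ∈ ⨆ (w : ℕ) (_ : w ≤ maxLen F + 1), mzvSpace w := by
  rw [integral_hev_eq F hint]
  exact Submodule.sub_mem _ (reg1_mem _ (maxLen_prim_le F)) (reg0_mem _ _)

end TheoremF1

end Hyperlog

end Literature.NumberTheory.Transcendental
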